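import Literature.NumberTheory.Sieve.BombieriFriedlanderIwaniecCaseTools
import HarnessLib

/-!
# Bombieri–Friedlander–Iwaniec 1986, §17: Case A — a partial product in the range of Theorems 1, 2

Topic `Literature/NumberTheory/Sieve`, companion to
`Literature.NumberTheory.Sieve.BombieriFriedlanderIwaniecCaseTools`.  Everything here is PROVED
(from the named facts `…Theorem1`, `…Theorem2`, `…Theorem0b`, `…Lemma3` of BFI 1986).  BFI §17,
p. 249: "Theorem 1 is applicable if `x^{2/7−ε} < N < x^{3/7+ε}` (17.1) and Theorem 2 is
applicable if `x^{1/7−ε} < N < x^{2/7+ε}` (17.2) … If there exists a partial sum `λ` of (15.6)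
with `1/7 ≤ λ ≤ 3/7` then (17.1) and (17.2) complete the proof."  With the bookkeeping of
`…Ranges` (level `x^{4/7−ε}`, split `D₂ = X'^{s−ε/100}`; in the Theorem 2 range the blocks with
`R < X'^{ρ_c}/2` are recombined for Theorem 0 (b), (15.3) p. 244), for pieces `α ⋆ β` with
`|α|, |β| ≤ τ^{13}`, `β` supported on `z`-rough integers (`z ≥ exp(√log x)`):

* `Literature.NumberTheory.Sieve.BFI.caseA1_bound` — `2/7 − 3ε/2 ≤ s ≤ 3/7 − ε + ε/100`, Theorem 1;
* `Literature.NumberTheory.Sieve.BFI.sparse_bound` — pieces with `‖β‖² (log 2N)^{c_D} < N` are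
  trivially admissible (BFI Lemma 3), which fixes the density exponent `c_D`;
* `Literature.NumberTheory.Sieve.BFI.thm2_blocks_bound`, `Literature.NumberTheory.Sieve.BFI.remainder_bound`,
  `Literature.NumberTheory.Sieve.BFI.caseA2_bound` — `3/14 − ε/2 + ε/200 ≤ s ≤ 2/7 − 3ε/2`,
  Theorem 2 on the blocks and Theorem 0 (b) ⊗ the trivial `τ²`-bound (Cauchy–Schwarz) on the
  recombined small moduli, for DENSE `β` (`N ≤ (log 2N)^{c_D} ‖β‖²`, which gives (A₅)).

All bounds have the shape `≤ C x (log x)^{−A₅}` for `x ≥ x₀`, the constants depending on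
`a, ε, A₅`, the (A₂)-constants `Csw` and `c_D`.

## References

* E. Bombieri, J. B. Friedlander, H. Iwaniec, *Primes in arithmetic progressions to large moduli*,
  Acta Math. 156 (1986), 203–251, §15 (15.3) p. 244, §17 (17.1)–(17.2) p. 249.
  [BombieriFriedlanderIwaniecActa1986]
-/

open Finset Real
open scoped ArithmeticFunction.sigma

namespace Literature.NumberTheory.Sieve

namespace BFI

/-! ### Case A1: Theorem 1 -/

/-- The large-`x` facts used by Case A1 (one existential witness). [folklore] -/
theorem eventually_caseA1 (x₁ x₂ : ℝ) :
    ∃ x₀ : ℝ, ∀ x : ℝ, x₀ ≤ x → x₁ ≤ x ∧ x₂ ≤ x ∧ Real.exp (Real.exp 1) ≤ x ∧ (2 : ℝ) ^ 105 ≤ x := by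
  refine ⟨max x₁ (max x₂ (max (Real.exp (Real.exp 1)) (2 ^ 105))), fun x hx => ⟨?_, ?_, ?_, ?_⟩⟩
  · exact le_trans (le_max_left _ _) hx
  · exact le_trans ((le_max_left _ _).trans (le_max_right _ _)) hx
  · exact le_trans ((le_max_left _ _).trans ((le_max_right _ _).trans (le_max_right _ _))) hx
  · exact le_trans ((le_max_right _ _).trans ((le_max_right _ _).trans (le_max_right _ _))) hx

/-- **Case A1 of §17: a partial product in the range of Theorem 1.**  Let `λ` be well factorable of
level `D = x^{4/7−ε}` (`0 < ε ≤ 1/1000`), `x ≤ X' ≤ 2^{15} x`, `MN = X'`, `N = X'^s` with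
`2/7 − 3ε/2 ≤ s ≤ 3/7 − ε + ε/100`, `|α|, |β| ≤ τ^{13}`, `β` supported on `z`-rough integers with
`z ≥ exp(√log x)`, and `β` satisfying (A₂) with exponent `2` and constants `Csw`.  Then, from
`Literature.NumberTheory.Sieve.BombieriFriedlanderIwaniecTheorem1` in the `𝒟`-form (blocks
`Q ≤ D₁/2`, `R ≤ D₂/2`, `D₂ = X'^{s−ε/100}`, ranges by `thm1_ranges`):
`|∑_{d ≤ D, (d,a)=1} λ(d) Δ_{α⋆β}(d)| ≤ C x (log x)^{−A₅}` for `x ≥ x₀ = x₀(a, ε, A₅, Csw)`.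
(BFI §17, p. 249, (17.1): "Theorem 1 is applicable if `x^{2/7−ε} < N < x^{3/7+ε}`".)
[cite: BombieriFriedlanderIwaniecActa1986, §17 (17.1) p. 249] -/
theorem caseA1_bound (h1 : BombieriFriedlanderIwaniecTheorem1) {a : ℤ} (ha : a ≠ 0)
    {ε : ℝ} (hε : 0 < ε) (hε' : ε ≤ 1 / 1000) {A₅ : ℝ} (hA₅ : 0 ≤ A₅) (Csw : ℝ → ℝ) :
    ∃ C x₀ : ℝ, 0 ≤ C ∧ ∀ x : ℝ, x₀ ≤ x → ∀ (X' M N s z : ℝ) (α β : ArithmeticFunction ℝ) (lam : ℕ → ℝ),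
      IsWellFactorable (x ^ (4 / 7 - ε)) lam →
      x ≤ X' → X' ≤ 2 ^ 15 * x → M * N = X' → N = X' ^ s →
      2 / 7 - 3 / 2 * ε ≤ s → s ≤ 3 / 7 - ε + ε / 100 →
      Real.exp (Real.sqrt (Real.log x)) ≤ z →
      (∀ m, |α m| ≤ (σ 0 m : ℝ) ^ 13) → (∀ n, |β n| ≤ (σ 0 n : ℝ) ^ 13) →
      (∀ n, β n ≠ 0 → IsRough z n) →
      SiegelWalfiszHyp N 2 Csw β →
      |∑ d ∈ (Icc 1 ⌊x ^ (4 / 7 - ε)⌋₊).filter (fun d : ℕ => IsCoprime (d : ℤ) a),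
          lam d * bilinDisc a M N α β d| ≤ C * x / Real.log x ^ A₅ := by
  obtain ⟨Cl, hCl, hl2⟩ := exists_l2Sq_le_of_abs_le_sigma_zero_pow 13
  obtain ⟨E', hE'⟩ : ∃ E' : ℕ, 2 ^ (2 * 13 + 1) = 2 * E' := ⟨2 ^ 26, by norm_num⟩
  rw [hE'] at hl2
  set A' : ℝ := 2 * A₅ + 4 * E' + 4 with hA'
  have hA'0 : 0 < A' := by rw [hA']; positivity
  obtain ⟨B₀, C₁, x₁, h1'⟩ := h1.dispD_sq_bound ha (ε := ε / 100) (by positivity) hA'0 (B := 2)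
    (by norm_num) Csw
  obtain ⟨x₂, hx₂⟩ := exists_log_rpow_lt_exp_sqrt B₀
  obtain ⟨x₀, hx₀⟩ := eventually_caseA1 x₁ x₂
  refine ⟨32 * 2 ^ 15 * 2 ^ (2 * E') * Real.sqrt (max C₁ 0) * Cl, x₀, by positivity,
    fun x hx X' M N s z α β lam hlam hxX hX'x hMN hNs hs1 hs2 hz hα hβ hβr hsw => ?_⟩
  obtain ⟨hx₁, hx₂', hxe, hx105⟩ := hx₀ x hx
  have hee : (2 : ℝ) < Real.exp (Real.exp 1) := by
    have h1 : (1 : ℝ) < Real.exp 1 := by have := Real.exp_one_gt_d9; linarith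
    have h2 : Real.exp 1 < Real.exp (Real.exp 1) := Real.exp_lt_exp.2 h1
    have := Real.exp_one_gt_d9; linarith
  have hx2 : (2 : ℝ) ≤ x := by linarith
  have hx0 : 0 < x := by linarith
  have hx1 : (1 : ℝ) ≤ x := by linarith
  have hX'2 : (2 : ℝ) ≤ X' := hx2.trans hxX
  have hX'0 : 0 < X' := by linarith
  have hX'1 : (1 : ℝ) < X' := by linarith
  have hLx : 1 ≤ Real.log x := by
    rw [Real.le_log_iff_exp_le hx0]
    refine le_trans ?_ hxe
    exact Real.exp_le_exp.2 (by have := Real.exp_one_gt_d9; linarith)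
  have hLX : Real.log x ≤ Real.log X' := Real.log_le_log hx0 hxX
  have hLX1 : 1 ≤ Real.log X' := hLx.trans hLX
  have hLX0 : 0 < Real.log X' := by linarith
  -- sizes of `M` and `N`
  have hN1 : 1 ≤ N := by rw [hNs]; exact Real.one_le_rpow hX'1.le (by linarith)
  have hNX : N ≤ X' := by
    rw [hNs]
    calc X' ^ s ≤ X' ^ (1 : ℝ) := Real.rpow_le_rpow_of_exponent_le hX'1.le (by linarith)
      _ = X' := Real.rpow_one X'
  have hN0 : 0 < N := by linarith
  have hM : M = X' ^ (1 - s) := by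
    have h : M = X' / N := by field_simp; linarith
    rw [h, hNs, Real.rpow_sub hX'0, Real.rpow_one]
  have hM1 : 1 ≤ M := by rw [hM]; exact Real.one_le_rpow hX'1.le (by linarith)
  have hMX : M ≤ X' := by
    rw [hM]
    calc X' ^ (1 - s) ≤ X' ^ (1 : ℝ) := Real.rpow_le_rpow_of_exponent_le hX'1.le (by linarith)
      _ = X' := Real.rpow_one X'
  have hM0 : 0 < M := by linarith
  -- the levels
  set D : ℝ := x ^ (4 / 7 - ε) with hD
  set D₂ : ℝ := X' ^ (s - ε / 100) with hD₂
  have hD₂1 : 1 ≤ D₂ := Real.one_le_rpow hX'1.le (by linarith)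
  have hD₂D : D₂ ≤ D := by
    calc D₂ ≤ x ^ (s - ε / 100 + 1 / 7) := rpow_scale_le hx105 hxX hX'x (by linarith) (by linarith)
      _ ≤ D := Real.rpow_le_rpow_of_exponent_le hx1 (by linarith)
  have hD₁le : D / D₂ ≤ X' ^ (4 / 7 - ε - (s - ε / 100)) := by
    have h1 : D ≤ X' ^ (4 / 7 - ε) := Real.rpow_le_rpow hx0.le hxX (by linarith)
    rw [div_le_iff₀ (by linarith)]
    have h2 : X' ^ (4 / 7 - ε - (s - ε / 100)) * D₂ = X' ^ (4 / 7 - ε) := by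
      rw [hD₂, ← Real.rpow_add hX'0]; congr 1; ring
    rw [h2]; exact h1
  obtain ⟨lam₁, lam₂, K₁, hl1, hl2', hs1', hs2', hK₁, hblocks, hdec⟩ := wellFactorable_blocks hlam hD₂1 hD₂D
  obtain ⟨K₂, hK₂, hK₂'⟩ := exists_pow_two_near hD₂1
  have hdec' := hdec a M N α β K₂
  have hfl : ⌊D₂ / 2 ^ K₂⌋₊ = 0 := Nat.floor_eq_zero.2 (by rw [div_lt_one (by positivity)]; exact hK₂)
  rw [hfl] at hdec'
  simp only [show (Icc 1 0 : Finset ℕ) = ∅ from rfl, Finset.sum_empty, Finset.sum_const_zero,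
    zero_add] at hdec'
  rw [hdec']
  -- hypotheses (A₃), (A₄) for the blocks
  have hγ : ∀ q, |lam₁ q| ≤ (σ 0 q : ℝ) ^ (2 : ℝ) := abs_le_sigma_rpow_two hl1
  have hzB : Real.log X' ^ B₀ < z := (hx₂ x X' hx₂' hxX hX'x).trans_le hz
  have hsift : IsSifted (dyadic N) (Real.log X' ^ B₀) β :=
    isSifted_of_rough_support hzB _ β.map_zero hβr
  -- the block bound
  set B : ℝ := 2 * Real.sqrt (max C₁ 0) * Cl * X' * (2 * Real.log X') ^ (2 * E') /
    Real.log X' ^ (A' / 2) with hB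
  have hB0 : 0 ≤ B := by rw [hB]; positivity
  have hblock : ∀ k, k < K₁ → ∀ k', k' < K₂ →
      |dispD a M N (D / D₂ / 2 ^ (k + 1)) (D₂ / 2 ^ (k' + 1)) α β lam₁ lam₂| ≤ B := by
    intro k hk k' hk'
    obtain ⟨hQ0, hQle⟩ := hblocks k hk
    set Q : ℝ := D / D₂ / 2 ^ (k + 1) with hQ
    set R : ℝ := D₂ / 2 ^ (k' + 1) with hR
    have hR0 : 1 / 2 ≤ R := by
      rw [hR, le_div_iff₀ (by positivity)]
      have hpow : (2 : ℝ) ^ (k' + 1) ≤ 2 ^ K₂ := pow_le_pow_right₀ (by norm_num) hk'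
      linarith
    have hRle : R ≤ X' ^ (s - ε / 100) / 2 := by
      rw [hR]
      exact div_le_div_of_nonneg_left (by linarith) (by norm_num) (le_self_pow₀ (by norm_num) (by omega))
    have hQle' : Q ≤ X' ^ (4 / 7 - ε - (s - ε / 100)) / 2 :=
      hQle.trans (div_le_div_of_nonneg_right hD₁le (by norm_num))
    obtain ⟨hN1', hN2', hQR, h4, h5, h6, h7⟩ :=
      thm1_ranges hε hε' hs1 hs2 hX'2 hNs hQ0 hR0 hQle' hRle
    have h := h1' X' (hx₁.trans hxX) M N Q R hMN hN1' hN2' hQ0 hR0 hQR h4 h5 h6 h7 β hsw hsift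
      α lam₁ lam₂ hγ
    have hR0' : 0 < R := by linarith
    have h' : dispD a M N Q R α β lam₁ lam₂ ^ 2 ≤
        (∑ r ∈ dyadic R, lam₂ r ^ 2) * (∑ m ∈ dyadic M, α m ^ 2) *
          (max C₁ 0 * l2Sq N β * X' * R⁻¹ / Real.log X' ^ A') := by
      refine h.trans (mul_le_mul_of_nonneg_left ?_
        (mul_nonneg (Finset.sum_nonneg fun _ _ => sq_nonneg _) (Finset.sum_nonneg fun _ _ => sq_nonneg _)))
      refine div_le_div_of_nonneg_right ?_ (Real.rpow_nonneg hLX0.le _)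
      exact mul_le_mul_of_nonneg_right (mul_le_mul_of_nonneg_right
        (mul_le_mul_of_nonneg_right (le_max_left _ _) (l2Sq_nonneg _ _)) hX'0.le) (inv_nonneg.2 hR0'.le)
    exact abs_dispD_le_of_sq_bound (le_max_right _ _) hCl hX'2 hMN hM1 hMX hN1 hNX hR0 hl2'
      (hl2 M hM1 α hα) (hl2 N hN1 β hβ) h'
  refine (abs_sum_sum_range_le hblock).trans ?_
  -- counting blocks, `log X'` versus `log x`
  have hD₁1 : 1 ≤ D / D₂ := by rwa [le_div_iff₀ (by linarith), one_mul]
  have hD₁X : D / D₂ ≤ X' := hD₁le.trans (by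
    calc X' ^ (4 / 7 - ε - (s - ε / 100)) ≤ X' ^ (1 : ℝ) :=
          Real.rpow_le_rpow_of_exponent_le hX'1.le (by linarith)
      _ = X' := Real.rpow_one X')
  have hD₂X : D₂ ≤ X' := by
    calc D₂ ≤ X' ^ (1 : ℝ) := Real.rpow_le_rpow_of_exponent_le hX'1.le (by linarith)
      _ = X' := Real.rpow_one X'
  have hK₁le : (K₁ : ℝ) ≤ 4 * Real.log X' := natCast_le_four_mul_log hK₁ hD₁1 hX'2 hD₁X
  have hK₂le : (K₂ : ℝ) ≤ 4 * Real.log X' := natCast_le_four_mul_log hK₂' hD₂1 hX'2 hD₂X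
  have hpow : Real.log X' ^ (2 * E' + 2) / Real.log X' ^ (A' / 2) ≤ (Real.log x ^ A₅)⁻¹ := by
    rw [← Real.rpow_natCast, ← Real.rpow_sub hLX0, ← Real.rpow_neg (by linarith)]
    have he : ((2 * E' + 2 : ℕ) : ℝ) - A' / 2 = -A₅ := by rw [hA']; push_cast; ring
    rw [he]
    exact Real.rpow_le_rpow_of_nonpos (by linarith) hLX (by linarith)
  calc (K₁ : ℝ) * K₂ * B ≤ (4 * Real.log X') * (4 * Real.log X') * B := by
        have hK₂0 : (0 : ℝ) ≤ K₂ := Nat.cast_nonneg _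
        exact mul_le_mul_of_nonneg_right (mul_le_mul hK₁le hK₂le hK₂0 (by positivity)) hB0
    _ = 32 * 2 ^ (2 * E') * Real.sqrt (max C₁ 0) * Cl * X' *
          (Real.log X' ^ (2 * E' + 2) / Real.log X' ^ (A' / 2)) := by
        rw [hB, mul_pow]; ring
    _ ≤ 32 * 2 ^ (2 * E') * Real.sqrt (max C₁ 0) * Cl * (2 ^ 15 * x) * (Real.log x ^ A₅)⁻¹ := by
        refine mul_le_mul (mul_le_mul_of_nonneg_left hX'x (by positivity)) hpow (by positivity)
          (by positivity)
    _ = 32 * 2 ^ 15 * 2 ^ (2 * E') * Real.sqrt (max C₁ 0) * Cl * x / Real.log x ^ A₅ := by ring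

/-! ### Sparse pieces -/

/-- The large-`x` facts used by the sparse case (one existential witness). [folklore] -/
theorem eventually_sparse (x₁ : ℝ) :
    ∃ x₀ : ℝ, ∀ x : ℝ, x₀ ≤ x → x₁ ≤ x ∧ Real.exp (Real.exp 1) ≤ x ∧ (2 : ℝ) ^ 20 ≤ x := by
  refine ⟨max x₁ (max (Real.exp (Real.exp 1)) (2 ^ 20)), fun x hx => ⟨?_, ?_, ?_⟩⟩
  · exact le_trans (le_max_left _ _) hx
  · exact le_trans ((le_max_left _ _).trans (le_max_right _ _)) hx
  · exact le_trans ((le_max_right _ _).trans (le_max_right _ _)) hx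

/-- **Sparse pieces are trivially admissible.**  For `a ≠ 0`, `A₅ ≥ 0` there are a density exponent
`c_D ≥ 0` and `C, x₀` such that for `x ≥ x₀`, `x ≤ X' ≤ 2^{15} x`, `MN = X'`, `N = X'^s` with
`1/5 ≤ s ≤ 9/20`, `|α| ≤ τ^{13}` on `m ∼ M`, `β` on `n ∼ N`, `|λ| ≤ 1`, and `β` SPARSE in the sense
`‖β‖² (log 2N)^{c_D} < N`:
`|∑_{d ≤ x^{4/7−ε}, (d,a)=1} λ(d) Δ_{α⋆β}(d)| ≤ C x (log x)^{−A₅}`.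
(The trivial bound `Literature.NumberTheory.Sieve.BFI.sum_tau_pow_abs_bilinDisc_le`, from BFI
Lemma 3, with Cauchy–Schwarz; the complement of the density hypothesis under which the dense
pieces satisfy (A₂), cf. `siegelWalfiszHyp_of_dense`.) [cite: BombieriFriedlanderIwaniecActa1986, §2 Lemma 3 p. 211; §15 p. 246] -/
theorem sparse_bound (hL3 : BombieriFriedlanderIwaniecLemma3) {a : ℤ} (ha : a ≠ 0)
    {ε : ℝ} (hε : 0 < ε) {A₅ : ℝ} (hA₅ : 0 ≤ A₅) :
    ∃ cD C x₀ : ℝ, 0 ≤ cD ∧ 0 ≤ C ∧ ∀ x : ℝ, x₀ ≤ x → ∀ (X' M N s : ℝ) (α β lam : ℕ → ℝ),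
      (∀ n, |lam n| ≤ 1) → x ≤ X' → X' ≤ 2 ^ 15 * x → M * N = X' → N = X' ^ s →
      1 / 5 ≤ s → s ≤ 9 / 20 →
      (∀ m, |α m| ≤ (σ 0 m : ℝ) ^ 13) → (∀ m, α m ≠ 0 → m ∈ dyadic M) →
      (∀ n, β n ≠ 0 → n ∈ dyadic N) →
      l2Sq N β * Real.log (2 * N) ^ cD < N →
      |∑ d ∈ (Icc 1 ⌊x ^ (4 / 7 - ε)⌋₊).filter (fun d : ℕ => IsCoprime (d : ℤ) a),
          lam d * bilinDisc a M N α β d| ≤ C * x / Real.log x ^ A₅ := by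
  obtain ⟨Bt, Ct, xt, hBt, hCt, ht⟩ := sum_tau_pow_abs_bilinDisc_le hL3 ha 13 0
  set r : ℕ := ⌈Bt⌉₊ with hr
  obtain ⟨Cτ, hCτ, hτ⟩ := exists_sum_dyadic_sigma_zero_pow_le (2 * r)
  obtain ⟨Ca, hCa, hCa'⟩ := exists_sum_abs_le_of_abs_le_sigma_zero_pow 13
  obtain ⟨Cφ, hCφ, hφ⟩ := exists_sum_sigma_zero_pow_div_totient_le_real 0
  obtain ⟨E, hE⟩ : ∃ E : ℕ, E = 2 ^ (13 + 1) := ⟨_, rfl⟩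
  rw [← hE] at hCa'
  set c₁ : ℕ := 2 ^ (2 * r + 1) with hc₁
  set K : ℝ := A₅ + Bt + E + 4 with hK
  have hK0 : 0 ≤ K := by rw [hK]; positivity
  obtain ⟨x₀, hx₀⟩ := eventually_sparse xt
  refine ⟨c₁ + 2 * K, (Ct * Real.sqrt Cτ + Cφ * Ca * Real.sqrt 3 * 2 ^ E) * 5 ^ K * 2 ^ 15, x₀,
    by positivity, by positivity,
    fun x hx X' M N s α β lam hlam hxX hX'x hMN hNs hs1 hs2 hα hαs hβs hsparse => ?_⟩
  obtain ⟨hxt, hxe, hx20⟩ := hx₀ x hx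
  have hee : (2 : ℝ) < Real.exp (Real.exp 1) := by
    have h1 : (1 : ℝ) < Real.exp 1 := by have := Real.exp_one_gt_d9; linarith
    have h2 : Real.exp 1 < Real.exp (Real.exp 1) := Real.exp_lt_exp.2 h1
    have := Real.exp_one_gt_d9; linarith
  have hx2 : (2 : ℝ) ≤ x := by linarith
  have hx0 : 0 < x := by linarith
  have hX'2 : (2 : ℝ) ≤ X' := hx2.trans hxX
  have hX'0 : 0 < X' := by linarith
  have hX'1 : (1 : ℝ) < X' := by linarith
  have hLx : 1 ≤ Real.log x := by
    rw [Real.le_log_iff_exp_le hx0]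
    refine le_trans ?_ hxe
    exact Real.exp_le_exp.2 (by have := Real.exp_one_gt_d9; linarith)
  have hLX : Real.log x ≤ Real.log X' := Real.log_le_log hx0 hxX
  have hLX1 : 1 ≤ Real.log X' := hLx.trans hLX
  have hLX0 : 0 < Real.log X' := by linarith
  -- sizes
  have hN1 : 1 ≤ N := by rw [hNs]; exact Real.one_le_rpow hX'1.le (by linarith)
  have hNX : N ≤ X' := by
    rw [hNs]
    calc X' ^ s ≤ X' ^ (1 : ℝ) := Real.rpow_le_rpow_of_exponent_le hX'1.le (by linarith)
      _ = X' := Real.rpow_one X'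
  have hN0 : 0 < N := by linarith
  have hM : M = X' ^ (1 - s) := by
    have h : M = X' / N := by field_simp; linarith
    rw [h, hNs, Real.rpow_sub hX'0, Real.rpow_one]
  have hM1 : 1 ≤ M := by rw [hM]; exact Real.one_le_rpow hX'1.le (by linarith)
  have hMX : M ≤ X' := by
    rw [hM]
    calc X' ^ (1 - s) ≤ X' ^ (1 : ℝ) := Real.rpow_le_rpow_of_exponent_le hX'1.le (by linarith)
      _ = X' := Real.rpow_one X'
  have hM0 : 0 < M := by linarith
  have h4N : 4 * N ^ 2 ≤ X' := by
    -- `N ≤ X'^{9/20}` and `X' ≥ 2^{20}` give `4 N² ≤ 4 X'^{9/10} ≤ X'`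
    have h1 : N ^ 2 ≤ X' ^ (9 / 10 : ℝ) := by
      rw [hNs, ← Real.rpow_natCast, ← Real.rpow_mul hX'0.le]
      exact Real.rpow_le_rpow_of_exponent_le hX'1.le (by push_cast; linarith)
    have h2 : (4 : ℝ) ≤ X' ^ (1 / 10 : ℝ) := by
      have h3 : (2 : ℝ) ^ 20 ≤ X' := hx20.trans hxX
      have h4 : ((4 : ℝ)) ^ (10 : ℕ) ≤ (X' ^ (1 / 10 : ℝ)) ^ (10 : ℕ) := by
        rw [← Real.rpow_natCast (X' ^ (1 / 10 : ℝ)) 10, ← Real.rpow_mul hX'0.le]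
        norm_num; linarith
      exact (pow_le_pow_iff_left₀ (by norm_num) (Real.rpow_nonneg hX'0.le _) (by norm_num)).1 h4
    calc 4 * N ^ 2 ≤ X' ^ (1 / 10 : ℝ) * X' ^ (9 / 10 : ℝ) :=
          mul_le_mul h2 h1 (sq_nonneg _) (Real.rpow_nonneg hX'0.le _)
      _ = X' := by rw [← Real.rpow_add hX'0]; norm_num
  set Dn : ℕ := ⌊x ^ (4 / 7 - ε)⌋₊ with hDn
  -- `log 2N`, `log 2M`
  set ℓ : ℝ := Real.log (2 * N) with hℓ
  have hℓ1 : Real.log X' / 5 ≤ ℓ := by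
    rw [hℓ]
    have h1 : Real.log N = s * Real.log X' := by rw [hNs, Real.log_rpow hX'0]
    have h2 : Real.log N ≤ Real.log (2 * N) := Real.log_le_log hN0 (by linarith)
    nlinarith
  have hLX5 : 5 ≤ Real.log X' := by
    have h1 : Real.log ((2 : ℝ) ^ 20) ≤ Real.log X' := Real.log_le_log (by norm_num) (hx20.trans hxX)
    rw [Real.log_pow] at h1
    have h2 : (0.6931471803 : ℝ) < Real.log 2 := Real.log_two_gt_d9
    push_cast at h1
    linarith
  have hℓone : 1 ≤ ℓ := by linarith
  have hℓ0 : 0 < ℓ := by linarith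
  have hlog2 : ∀ {T : ℝ}, 1 ≤ T → T ≤ X' → Real.log (2 * T) ≤ 2 * Real.log X' := by
    intro T hT1 hTX
    have h1 : 2 * T ≤ X' ^ 2 := by nlinarith
    calc Real.log (2 * T) ≤ Real.log (X' ^ 2) := Real.log_le_log (by linarith) h1
      _ = 2 * Real.log X' := by rw [Real.log_pow]; norm_num
  -- sparseness: `‖β‖² ≤ N ℓ^{-c_D}`, `‖β‖ ≤ √N ℓ^{-c_D/2}`
  have hcD : ((c₁ : ℝ) + 2 * K) = 2 * ((c₁ : ℝ) / 2 + K) := by ring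
  have hsqrtβ : Real.sqrt (l2Sq N β) ≤ Real.sqrt N * ℓ ^ (-((c₁ : ℝ) / 2 + K)) := by
    have h1 : l2Sq N β ≤ N * ℓ ^ (-((c₁ : ℝ) + 2 * K)) := by
      rw [Real.rpow_neg hℓ0.le, ← div_eq_mul_inv, le_div_iff₀ (Real.rpow_pos_of_pos hℓ0 _)]
      exact hsparse.le
    calc Real.sqrt (l2Sq N β) ≤ Real.sqrt (N * ℓ ^ (-((c₁ : ℝ) + 2 * K))) := Real.sqrt_le_sqrt h1
      _ = Real.sqrt N * ℓ ^ (-((c₁ : ℝ) / 2 + K)) := by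
          rw [Real.sqrt_mul hN0.le, Real.sqrt_eq_rpow (ℓ ^ (-((c₁ : ℝ) + 2 * K))), ← Real.rpow_mul hℓ0.le]
          congr 2; ring
  -- `∑ |β_n| τ(n)^{Bt} ≤ ‖β‖ (C_τ N ℓ^{c₁})^{1/2} ≤ √C_τ N ℓ^{-K}`
  have hβτ : ∑ n ∈ dyadic N, |β n| * (σ 0 n : ℝ) ^ Bt ≤ Real.sqrt Cτ * N * ℓ ^ (-K) := by
    have h1 : ∑ n ∈ dyadic N, |β n| * (σ 0 n : ℝ) ^ Bt ≤ ∑ n ∈ dyadic N, |β n| * (σ 0 n : ℝ) ^ r := by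
      refine Finset.sum_le_sum fun n hn => mul_le_mul_of_nonneg_left ?_ (abs_nonneg _)
      have hn0 : n ≠ 0 := (pos_of_mem_dyadic hN0.le hn).ne'
      have hτ1 : (1 : ℝ) ≤ (σ 0 n : ℝ) := by exact_mod_cast one_le_sigma_zero hn0
      rw [← Real.rpow_natCast]
      exact Real.rpow_le_rpow_of_exponent_le hτ1 (Nat.le_ceil Bt)
    have h2 := sum_abs_mul_sigma_pow_le N β r
    have h3 : Real.sqrt (∑ n ∈ dyadic N, (σ 0 n : ℝ) ^ (2 * r)) ≤ Real.sqrt (Cτ * N) * ℓ ^ ((c₁ : ℝ) / 2) := by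
      calc Real.sqrt (∑ n ∈ dyadic N, (σ 0 n : ℝ) ^ (2 * r)) ≤ Real.sqrt (Cτ * N * ℓ ^ c₁) :=
            Real.sqrt_le_sqrt (hτ N hN1)
        _ = Real.sqrt (Cτ * N) * ℓ ^ ((c₁ : ℝ) / 2) := by
            rw [Real.sqrt_mul (by positivity), Real.sqrt_eq_rpow (ℓ ^ c₁), ← Real.rpow_natCast,
              ← Real.rpow_mul hℓ0.le]
            congr 2; ring
    calc ∑ n ∈ dyadic N, |β n| * (σ 0 n : ℝ) ^ Bt
        ≤ Real.sqrt (l2Sq N β) * Real.sqrt (∑ n ∈ dyadic N, (σ 0 n : ℝ) ^ (2 * r)) := h1.trans h2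
      _ ≤ (Real.sqrt N * ℓ ^ (-((c₁ : ℝ) / 2 + K))) * (Real.sqrt (Cτ * N) * ℓ ^ ((c₁ : ℝ) / 2)) :=
          mul_le_mul hsqrtβ h3 (Real.sqrt_nonneg _) (by positivity)
      _ = Real.sqrt Cτ * N * ℓ ^ (-K) := by
          rw [Real.sqrt_mul hCτ.le]
          have h4 : ℓ ^ (-((c₁ : ℝ) / 2 + K)) * ℓ ^ ((c₁ : ℝ) / 2) = ℓ ^ (-K) := by
            rw [← Real.rpow_add hℓ0]; congr 1; ring
          have h5 : Real.sqrt N * Real.sqrt N = N := Real.mul_self_sqrt hN0.le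
          calc Real.sqrt N * ℓ ^ (-((c₁ : ℝ) / 2 + K)) * (Real.sqrt Cτ * Real.sqrt N * ℓ ^ ((c₁ : ℝ) / 2))
              = Real.sqrt Cτ * (Real.sqrt N * Real.sqrt N) *
                  (ℓ ^ (-((c₁ : ℝ) / 2 + K)) * ℓ ^ ((c₁ : ℝ) / 2)) := by ring
            _ = _ := by rw [h4, h5]
  -- `‖β‖₁ ≤ √3 N ℓ^{-K}`
  have hβ1 : ∑ n ∈ dyadic N, |β n| ≤ Real.sqrt 3 * N * ℓ ^ (-K) := by
    have h1 := sum_abs_le_sqrt_l2Sq hN0.le β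
    have h2 : Real.sqrt (2 * N + 1) ≤ Real.sqrt 3 * Real.sqrt N := by
      rw [← Real.sqrt_mul (by norm_num)]
      exact Real.sqrt_le_sqrt (by linarith)
    have h3 : ℓ ^ (-((c₁ : ℝ) / 2 + K)) ≤ ℓ ^ (-K) :=
      Real.rpow_le_rpow_of_exponent_le hℓone (by have : (0:ℝ) ≤ c₁ := Nat.cast_nonneg _; linarith)
    calc ∑ n ∈ dyadic N, |β n| ≤ Real.sqrt (l2Sq N β) * Real.sqrt (2 * N + 1) := h1
      _ ≤ (Real.sqrt N * ℓ ^ (-K)) * (Real.sqrt 3 * Real.sqrt N) := by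
          refine mul_le_mul (hsqrtβ.trans (mul_le_mul_of_nonneg_left h3 (Real.sqrt_nonneg _))) h2
            (Real.sqrt_nonneg _) (by positivity)
      _ = Real.sqrt 3 * N * ℓ ^ (-K) := by
          have h5 : Real.sqrt N * Real.sqrt N = N := Real.mul_self_sqrt hN0.le
          calc Real.sqrt N * ℓ ^ (-K) * (Real.sqrt 3 * Real.sqrt N)
              = Real.sqrt 3 * (Real.sqrt N * Real.sqrt N) * ℓ ^ (-K) := by ring
            _ = _ := by rw [h5]
  -- `‖α‖₁ ≤ C_a M (2 log X')^E`, `∑ 1/φ ≤ C_φ (log X')^4`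
  have hα1 : ∑ m ∈ dyadic M, |α m| ≤ Ca * M * (2 * Real.log X') ^ E :=
    (hCa' M hM1 α hα).trans (mul_le_mul_of_nonneg_left
      (pow_le_pow_left₀ (Real.log_nonneg (by linarith)) (hlog2 hM1 hMX) E) (by positivity))
  have hΦ : ∑ d ∈ Icc 1 Dn, ((Nat.totient d : ℝ))⁻¹ ≤ Cφ * Real.log X' ^ 4 := by
    have h := hφ X' hX'2
    simp only [pow_zero, one_div] at h
    norm_num at h
    have hDnX : Dn ≤ ⌊X'⌋₊ := by
      refine Nat.floor_le_floor ?_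
      calc x ^ (4 / 7 - ε) ≤ x ^ (1 : ℝ) := Real.rpow_le_rpow_of_exponent_le (by linarith) (by linarith)
        _ = x := Real.rpow_one x
        _ ≤ X' := hxX
    exact le_trans (Finset.sum_le_sum_of_subset_of_nonneg (Finset.Icc_subset_Icc le_rfl hDnX)
      fun _ _ _ => inv_nonneg.2 (Nat.cast_nonneg _)) h
  -- `ℓ^{-K} ≤ 5^K (log X')^{-K}` and the `log X'` powers
  have hℓK : ℓ ^ (-K) ≤ 5 ^ K * Real.log X' ^ (-K) := by
    calc ℓ ^ (-K) ≤ (Real.log X' / 5) ^ (-K) := Real.rpow_le_rpow_of_nonpos (by positivity) hℓ1 (by linarith)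
      _ = 5 ^ K * Real.log X' ^ (-K) := by
          rw [div_eq_mul_inv, Real.mul_rpow hLX0.le (by norm_num), Real.inv_rpow (by norm_num),
            Real.rpow_neg (by norm_num : (0:ℝ) ≤ 5), inv_inv]; ring
  have hpow1 : Real.log X' ^ Bt * Real.log X' ^ (-K) ≤ (Real.log x ^ A₅)⁻¹ := by
    rw [← Real.rpow_add hLX0, ← Real.rpow_neg (by linarith)]
    calc Real.log X' ^ (Bt + -K) ≤ Real.log X' ^ (-A₅) :=
          Real.rpow_le_rpow_of_exponent_le hLX1 (by rw [hK]; have : (0:ℝ) ≤ E := Nat.cast_nonneg _; linarith)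
      _ ≤ Real.log x ^ (-A₅) := Real.rpow_le_rpow_of_nonpos (by linarith) hLX (by linarith)
  have hpow2 : Real.log X' ^ 4 * (2 * Real.log X') ^ E * Real.log X' ^ (-K) ≤ 2 ^ E * (Real.log x ^ A₅)⁻¹ := by
    rw [mul_pow, show Real.log X' ^ 4 * (2 ^ E * Real.log X' ^ E) = 2 ^ E * Real.log X' ^ (E + 4) by ring]
    rw [mul_assoc]
    refine mul_le_mul_of_nonneg_left ?_ (by positivity)
    rw [← Real.rpow_natCast, ← Real.rpow_add hLX0, ← Real.rpow_neg (by linarith)]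
    calc Real.log X' ^ (((E + 4 : ℕ) : ℝ) + -K) ≤ Real.log X' ^ (-A₅) :=
          Real.rpow_le_rpow_of_exponent_le hLX1 (by rw [hK]; push_cast; linarith)
      _ ≤ Real.log x ^ (-A₅) := Real.rpow_le_rpow_of_nonpos (by linarith) hLX (by linarith)
  have hT1 : Ct * M * Real.log X' ^ Bt * ∑ n ∈ dyadic N, |β n| * (σ 0 n : ℝ) ^ Bt ≤
      Ct * Real.sqrt Cτ * 5 ^ K * X' * (Real.log x ^ A₅)⁻¹ := by
    have i1 : ∑ n ∈ dyadic N, |β n| * (σ 0 n : ℝ) ^ Bt ≤ Real.sqrt Cτ * N * (5 ^ K * Real.log X' ^ (-K)) :=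
      hβτ.trans (mul_le_mul_of_nonneg_left hℓK (mul_nonneg (Real.sqrt_nonneg _) hN0.le))
    have i0 : 0 ≤ Ct * M * Real.log X' ^ Bt :=
      mul_nonneg (mul_nonneg hCt hM0.le) (Real.rpow_nonneg hLX0.le _)
    have i2 := mul_le_mul_of_nonneg_left i1 i0
    have i3 : Ct * M * Real.log X' ^ Bt * (Real.sqrt Cτ * N * (5 ^ K * Real.log X' ^ (-K))) =
        Ct * Real.sqrt Cτ * 5 ^ K * (M * N) * (Real.log X' ^ Bt * Real.log X' ^ (-K)) := by ring
    have h5K : (0 : ℝ) ≤ 5 ^ K := Real.rpow_nonneg (by norm_num) _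
    have i4 : 0 ≤ Ct * Real.sqrt Cτ * 5 ^ K * (M * N) := by
      rw [hMN]; exact mul_nonneg (mul_nonneg (mul_nonneg hCt (Real.sqrt_nonneg _)) h5K) hX'0.le
    have i5 := mul_le_mul_of_nonneg_left hpow1 i4
    rw [hMN] at i3 i5
    exact (i2.trans i3.le).trans i5
  have hT2 : (∑ d ∈ Icc 1 Dn, ((Nat.totient d : ℝ))⁻¹) * (∑ m ∈ dyadic M, |α m|) * ∑ n ∈ dyadic N, |β n| ≤
      Cφ * Ca * Real.sqrt 3 * 2 ^ E * 5 ^ K * X' * (Real.log x ^ A₅)⁻¹ := by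
    have hL4 : 0 ≤ Cφ * Real.log X' ^ 4 := mul_nonneg hCφ.le (pow_nonneg hLX0.le 4)
    have i1 : (∑ d ∈ Icc 1 Dn, ((Nat.totient d : ℝ))⁻¹) * (∑ m ∈ dyadic M, |α m|) ≤
        (Cφ * Real.log X' ^ 4) * (Ca * M * (2 * Real.log X') ^ E) :=
      mul_le_mul hΦ hα1 (Finset.sum_nonneg fun _ _ => abs_nonneg _) hL4
    have i2 : ∑ n ∈ dyadic N, |β n| ≤ Real.sqrt 3 * N * (5 ^ K * Real.log X' ^ (-K)) :=
      hβ1.trans (mul_le_mul_of_nonneg_left hℓK (mul_nonneg (Real.sqrt_nonneg _) hN0.le))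
    have i0 : 0 ≤ (Cφ * Real.log X' ^ 4) * (Ca * M * (2 * Real.log X') ^ E) :=
      mul_nonneg hL4 (mul_nonneg (mul_nonneg hCa.le hM0.le) (pow_nonneg (mul_nonneg zero_le_two hLX0.le) E))
    have i3 := mul_le_mul i1 i2 (Finset.sum_nonneg fun _ _ => abs_nonneg _) i0
    have i4 : (Cφ * Real.log X' ^ 4) * (Ca * M * (2 * Real.log X') ^ E) * (Real.sqrt 3 * N * (5 ^ K * Real.log X' ^ (-K))) =
        Cφ * Ca * Real.sqrt 3 * 5 ^ K * (M * N) *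
          (Real.log X' ^ 4 * (2 * Real.log X') ^ E * Real.log X' ^ (-K)) := by ring
    have h5K : (0 : ℝ) ≤ 5 ^ K := Real.rpow_nonneg (by norm_num) _
    have i5 : 0 ≤ Cφ * Ca * Real.sqrt 3 * 5 ^ K * (M * N) := by
      rw [hMN]
      exact mul_nonneg (mul_nonneg (mul_nonneg (mul_nonneg hCφ.le hCa.le) (Real.sqrt_nonneg _)) h5K) hX'0.le
    have i6 := mul_le_mul_of_nonneg_left hpow2 i5
    rw [hMN] at i4 i6
    calc _ ≤ _ := i3
      _ = _ := i4
      _ ≤ _ := i6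
      _ = _ := by ring
  -- assemble: the trivial bound
  have hmain := ht X' M N (hxt.trans hxX) hN1 h4N hMN α β hα hαs hβs Dn
  simp only [pow_zero, one_mul] at hmain
  have hfilter : |∑ d ∈ (Icc 1 Dn).filter (fun d : ℕ => IsCoprime (d : ℤ) a), lam d * bilinDisc a M N α β d| ≤
      ∑ d ∈ Icc 1 Dn, |bilinDisc a M N α β d| := by
    refine (Finset.abs_sum_le_sum_abs _ _).trans ?_
    refine (Finset.sum_le_sum fun d _ => ?_).trans
      (Finset.sum_le_sum_of_subset_of_nonneg (Finset.filter_subset _ _) fun _ _ _ => abs_nonneg _)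
    rw [abs_mul]
    exact (mul_le_mul_of_nonneg_right (hlam d) (abs_nonneg _)).trans (by rw [one_mul])
  refine hfilter.trans (hmain.trans ?_)
  have hsimp : (∑ d ∈ Icc 1 Dn, 1 / (Nat.totient d : ℝ)) = ∑ d ∈ Icc 1 Dn, ((Nat.totient d : ℝ))⁻¹ :=
    Finset.sum_congr rfl fun d _ => one_div _
  rw [hsimp]
  refine (add_le_add hT1 hT2).trans ?_
  have hLA : 0 ≤ (Real.log x ^ A₅)⁻¹ := inv_nonneg.2 (Real.rpow_nonneg (zero_le_one.trans hLx) _)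
  have hX'x' : X' * (Real.log x ^ A₅)⁻¹ ≤ 2 ^ 15 * x * (Real.log x ^ A₅)⁻¹ :=
    mul_le_mul_of_nonneg_right hX'x hLA
  calc Ct * Real.sqrt Cτ * 5 ^ K * X' * (Real.log x ^ A₅)⁻¹ +
        Cφ * Ca * Real.sqrt 3 * 2 ^ E * 5 ^ K * X' * (Real.log x ^ A₅)⁻¹
      = (Ct * Real.sqrt Cτ + Cφ * Ca * Real.sqrt 3 * 2 ^ E) * 5 ^ K * (X' * (Real.log x ^ A₅)⁻¹) := by ring
    _ ≤ (Ct * Real.sqrt Cτ + Cφ * Ca * Real.sqrt 3 * 2 ^ E) * 5 ^ K * (2 ^ 15 * x * (Real.log x ^ A₅)⁻¹) := by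
        refine mul_le_mul_of_nonneg_left hX'x' (mul_nonneg ?_ (Real.rpow_nonneg (by norm_num) _))
        exact add_nonneg (mul_nonneg hCt (Real.sqrt_nonneg _))
          (mul_nonneg (mul_nonneg (mul_nonneg hCφ.le hCa.le) (Real.sqrt_nonneg _)) (pow_nonneg (by norm_num) E))
    _ = (Ct * Real.sqrt Cτ + Cφ * Ca * Real.sqrt 3 * 2 ^ E) * 5 ^ K * 2 ^ 15 * x / Real.log x ^ A₅ := by ring

/-! ### Case A2: Theorem 2 on the blocks -/

/-- The large-`x` facts used by the Theorem 2 blocks (one existential witness). [folklore] -/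
theorem eventually_caseA2 (x₁ x₂ x₃ : ℝ) :
    ∃ x₀ : ℝ, ∀ x : ℝ, x₀ ≤ x → x₁ ≤ x ∧ x₂ ≤ x ∧ x₃ ≤ x ∧ Real.exp (Real.exp 1) ≤ x ∧ (2 : ℝ) ^ 105 ≤ x := by
  refine ⟨max x₁ (max x₂ (max x₃ (max (Real.exp (Real.exp 1)) (2 ^ 105)))), fun x hx => ⟨?_, ?_, ?_, ?_, ?_⟩⟩
  · exact le_trans (le_max_left _ _) hx
  · exact le_trans ((le_max_left _ _).trans (le_max_right _ _)) hx
  · exact le_trans ((le_max_left _ _).trans ((le_max_right _ _).trans (le_max_right _ _))) hx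
  · exact le_trans ((le_max_left _ _).trans ((le_max_right _ _).trans ((le_max_right _ _).trans
      (le_max_right _ _)))) hx
  · exact le_trans ((le_max_right _ _).trans ((le_max_right _ _).trans ((le_max_right _ _).trans
      (le_max_right _ _)))) hx

/-- **Case A2 of §17, the Theorem 2 blocks.**  In the range `3/14 − ε/2 + ε/200 ≤ s ≤ 2/7 − 3ε/2`
(`N = X'^s`, `MN = X'`, `x ≤ X' ≤ 2^{15} x`), for a dense `β` (`N ≤ (log 2N)^{c_D} ‖β‖²`) with
`|α|, |β| ≤ τ^{13}`, `β` `z`-rough-supported (`z ≥ exp(√log x)`) and obeying (A₂) (exponent `2`,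
constants `Csw`), and `λ₁, λ₂` bounded by `1`: the dyadic blocks `Q = D₁/2^{k+1}` (`k < K₁`,
`2^{K₁} ≤ 2D₁`, `D₁ = x^{4/7−ε}/D₂`, `D₂ = X'^{s−ε/100}`) and `R = D₂/2^{k'+1}` (`k' < K₂`,
`D₂/2^{K₂} ≥ X'^{ρ_c}/2`, `ρ_c = 1/7 − 2ε + 5ε/100`, `2^{K₂} ≤ 2D₂`) satisfy
`|∑_{k<K₁} ∑_{k'<K₂} 𝒟(M,N,Q,R)| ≤ C x (log x)^{−A₅}` for `x ≥ x₀`, by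
`Literature.NumberTheory.Sieve.BombieriFriedlanderIwaniecTheorem2` (𝒟-form; ranges `thm2_ranges`,
(A₅) by `a5_of_dense`).  (BFI §17 (17.2), p. 249.) [cite: BombieriFriedlanderIwaniecActa1986, §17 (17.2) p. 249] -/
theorem thm2_blocks_bound (h2 : BombieriFriedlanderIwaniecTheorem2) {a : ℤ} (ha : a ≠ 0)
    {ε : ℝ} (hε : 0 < ε) (hε' : ε ≤ 1 / 1000) {A₅ : ℝ} (hA₅ : 0 ≤ A₅) (Csw : ℝ → ℝ)
    {cD : ℝ} (hcD : 0 ≤ cD) :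
    ∃ C x₀ : ℝ, 0 ≤ C ∧ ∀ x : ℝ, x₀ ≤ x → ∀ (X' M N s z : ℝ) (α β lam₁ lam₂ : ArithmeticFunction ℝ)
      (K₁ K₂ : ℕ),
      (∀ n, |lam₁ n| ≤ 1) → (∀ n, |lam₂ n| ≤ 1) →
      x ≤ X' → X' ≤ 2 ^ 15 * x → M * N = X' → N = X' ^ s →
      3 / 14 - ε / 2 + ε / 200 ≤ s → s ≤ 2 / 7 - 3 / 2 * ε →
      Real.exp (Real.sqrt (Real.log x)) ≤ z →
      (2 : ℝ) ^ K₁ ≤ 2 * (x ^ (4 / 7 - ε) / X' ^ (s - ε / 100)) →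
      (2 : ℝ) ^ K₂ ≤ 2 * X' ^ (s - ε / 100) →
      X' ^ (1 / 7 - 2 * ε + 5 * (ε / 100)) / 2 ≤ X' ^ (s - ε / 100) / 2 ^ K₂ →
      (∀ m, |α m| ≤ (σ 0 m : ℝ) ^ 13) → (∀ n, |β n| ≤ (σ 0 n : ℝ) ^ 13) →
      (∀ n, β n ≠ 0 → IsRough z n) →
      SiegelWalfiszHyp N 2 Csw β →
      N ≤ Real.log (2 * N) ^ cD * l2Sq N β →
      |∑ k ∈ Finset.range K₁, ∑ k' ∈ Finset.range K₂,
          dispD a M N (x ^ (4 / 7 - ε) / X' ^ (s - ε / 100) / 2 ^ (k + 1))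
            (X' ^ (s - ε / 100) / 2 ^ (k' + 1)) α β lam₁ lam₂| ≤ C * x / Real.log x ^ A₅ := by
  obtain ⟨Cl, hCl, hl2⟩ := exists_l2Sq_le_of_abs_le_sigma_zero_pow 13
  obtain ⟨E', hE'⟩ : ∃ E' : ℕ, 2 ^ (2 * 13 + 1) = 2 * E' := ⟨2 ^ 26, by norm_num⟩
  rw [hE'] at hl2
  set A' : ℝ := 2 * A₅ + 4 * E' + 4 with hA'
  have hA'0 : 0 < A' := by rw [hA']; positivity
  obtain ⟨ε₅, B₀, C₂, x₁, hε₅, h2'⟩ := h2.dispD_sq_bound ha (ε := ε / 100) (by positivity) hA'0 (B := 2)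
    (by norm_num) Csw 1
  obtain ⟨x₂, hx₂⟩ := exists_log_rpow_lt_exp_sqrt B₀
  obtain ⟨x₃, hx₃⟩ := a5_of_dense hcD hε₅
  obtain ⟨x₀, hx₀⟩ := eventually_caseA2 x₁ x₂ x₃
  refine ⟨32 * 2 ^ 15 * 2 ^ (2 * E') * Real.sqrt (max C₂ 0) * Cl, x₀, by positivity,
    fun x hx X' M N s z α β lam₁ lam₂ K₁ K₂ hl1 hl2' hxX hX'x hMN hNs hs1 hs2 hz hK₁ hK₂' hK₂
      hα hβ hβr hsw hdense => ?_⟩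
  obtain ⟨hx₁, hx₂', hx₃', hxe, hx105⟩ := hx₀ x hx
  have hee : (2 : ℝ) < Real.exp (Real.exp 1) := by
    have h1 : (1 : ℝ) < Real.exp 1 := by have := Real.exp_one_gt_d9; linarith
    have h2 : Real.exp 1 < Real.exp (Real.exp 1) := Real.exp_lt_exp.2 h1
    have := Real.exp_one_gt_d9; linarith
  have hx2 : (2 : ℝ) ≤ x := by linarith
  have hx0 : 0 < x := by linarith
  have hx1 : (1 : ℝ) ≤ x := by linarith
  have hX'2 : (2 : ℝ) ≤ X' := hx2.trans hxX
  have hX'0 : 0 < X' := by linarith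
  have hX'1 : (1 : ℝ) < X' := by linarith
  have hLx : 1 ≤ Real.log x := by
    rw [Real.le_log_iff_exp_le hx0]
    refine le_trans ?_ hxe
    exact Real.exp_le_exp.2 (by have := Real.exp_one_gt_d9; linarith)
  have hLX : Real.log x ≤ Real.log X' := Real.log_le_log hx0 hxX
  have hLX1 : 1 ≤ Real.log X' := hLx.trans hLX
  have hLX0 : 0 < Real.log X' := by linarith
  -- sizes of `M` and `N`
  have hN1 : 1 ≤ N := by rw [hNs]; exact Real.one_le_rpow hX'1.le (by linarith)
  have hNX : N ≤ X' := by
    rw [hNs]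
    calc X' ^ s ≤ X' ^ (1 : ℝ) := Real.rpow_le_rpow_of_exponent_le hX'1.le (by linarith)
      _ = X' := Real.rpow_one X'
  have hN0 : 0 < N := by linarith
  have hM : M = X' ^ (1 - s) := by
    have h : M = X' / N := by field_simp; linarith
    rw [h, hNs, Real.rpow_sub hX'0, Real.rpow_one]
  have hM1 : 1 ≤ M := by rw [hM]; exact Real.one_le_rpow hX'1.le (by linarith)
  have hMX : M ≤ X' := by
    rw [hM]
    calc X' ^ (1 - s) ≤ X' ^ (1 : ℝ) := Real.rpow_le_rpow_of_exponent_le hX'1.le (by linarith)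
      _ = X' := Real.rpow_one X'
  have hM0 : 0 < M := by linarith
  -- the levels
  set D : ℝ := x ^ (4 / 7 - ε) with hD
  set D₂ : ℝ := X' ^ (s - ε / 100) with hD₂
  have hD₂1 : 1 ≤ D₂ := Real.one_le_rpow hX'1.le (by linarith)
  have hD₂0 : 0 < D₂ := by linarith
  have hD₁le : D / D₂ ≤ X' ^ (4 / 7 - ε - (s - ε / 100)) := by
    have h1 : D ≤ X' ^ (4 / 7 - ε) := Real.rpow_le_rpow hx0.le hxX (by linarith)
    rw [div_le_iff₀ hD₂0]
    have h2 : X' ^ (4 / 7 - ε - (s - ε / 100)) * D₂ = X' ^ (4 / 7 - ε) := by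
      rw [hD₂, ← Real.rpow_add hX'0]; congr 1; ring
    rw [h2]; exact h1
  -- hypotheses (A₃), (A₄), (A₅)
  have hγ : ∀ q, |lam₁ q| ≤ (σ 0 q : ℝ) ^ (2 : ℝ) := abs_le_sigma_rpow_two hl1
  have hzB : Real.log X' ^ B₀ < z := (hx₂ x X' hx₂' hxX hX'x).trans_le hz
  have hsift : IsSifted (dyadic N) (Real.log X' ^ B₀) β :=
    isSifted_of_rough_support hzB _ β.map_zero hβr
  have ha5 : N ^ (1 - ε₅) * (∑ n ∈ dyadic N, β n ^ 4) ≤ 1 * l2Sq N β ^ 2 :=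
    hx₃ x hx₃' X' N s β hxX hX'x hNs (by linarith) (by linarith) hβ hdense
  -- the block bound
  set B : ℝ := 2 * Real.sqrt (max C₂ 0) * Cl * X' * (2 * Real.log X') ^ (2 * E') /
    Real.log X' ^ (A' / 2) with hB
  have hB0 : 0 ≤ B := by rw [hB]; positivity
  have hblock : ∀ k, k < K₁ → ∀ k', k' < K₂ →
      |dispD a M N (D / D₂ / 2 ^ (k + 1)) (D₂ / 2 ^ (k' + 1)) α β lam₁ lam₂| ≤ B := by
    intro k hk k' hk'
    set Q : ℝ := D / D₂ / 2 ^ (k + 1) with hQ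
    set R : ℝ := D₂ / 2 ^ (k' + 1) with hR
    have hQ0 : 1 / 2 ≤ Q := by
      rw [hQ, le_div_iff₀ (by positivity)]
      have hpow : (2 : ℝ) ^ (k + 1) ≤ 2 ^ K₁ := pow_le_pow_right₀ (by norm_num) hk
      linarith
    have hQle : Q ≤ X' ^ (4 / 7 - ε - (s - ε / 100)) / 2 := by
      rw [hQ]
      calc D / D₂ / 2 ^ (k + 1) ≤ D / D₂ / 2 :=
            div_le_div_of_nonneg_left (by positivity) (by norm_num) (le_self_pow₀ (by norm_num) (by omega))
        _ ≤ X' ^ (4 / 7 - ε - (s - ε / 100)) / 2 := div_le_div_of_nonneg_right hD₁le (by norm_num)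
    have hRc : X' ^ (1 / 7 - 2 * ε + 5 * (ε / 100)) / 2 ≤ R := by
      refine hK₂.trans ?_
      rw [hR]
      exact div_le_div_of_nonneg_left hD₂0.le (by positivity) (pow_le_pow_right₀ (by norm_num) hk')
    have hRle : R ≤ X' ^ (s - ε / 100) / 2 := by
      rw [hR]
      exact div_le_div_of_nonneg_left hD₂0.le (by norm_num) (le_self_pow₀ (by norm_num) (by omega))
    have hR0 : 1 / 2 ≤ R := le_trans (by
      have : (1 : ℝ) ≤ X' ^ (1 / 7 - 2 * ε + 5 * (ε / 100)) := Real.one_le_rpow hX'1.le (by linarith)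
      linarith) hRc
    obtain ⟨hN1', hN2', hQR, h4, h5, h6, h7⟩ :=
      thm2_ranges hε hε' hs1 hs2 hX'2 hNs hQ0 hQle hRc hRle
    have h := h2' X' (hx₁.trans hxX) M N Q R hMN hN1' hN2' hQ0 hR0 hQR h4 h5 h6 h7 β hsw hsift ha5
      α lam₁ lam₂ hγ
    have hR0' : 0 < R := by linarith
    have h' : dispD a M N Q R α β lam₁ lam₂ ^ 2 ≤
        (∑ r ∈ dyadic R, lam₂ r ^ 2) * (∑ m ∈ dyadic M, α m ^ 2) *
          (max C₂ 0 * l2Sq N β * X' * R⁻¹ / Real.log X' ^ A') := by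
      refine h.trans (mul_le_mul_of_nonneg_left ?_
        (mul_nonneg (Finset.sum_nonneg fun _ _ => sq_nonneg _) (Finset.sum_nonneg fun _ _ => sq_nonneg _)))
      refine div_le_div_of_nonneg_right ?_ (Real.rpow_nonneg hLX0.le _)
      exact mul_le_mul_of_nonneg_right (mul_le_mul_of_nonneg_right
        (mul_le_mul_of_nonneg_right (le_max_left _ _) (l2Sq_nonneg _ _)) hX'0.le) (inv_nonneg.2 hR0'.le)
    exact abs_dispD_le_of_sq_bound (le_max_right _ _) hCl hX'2 hMN hM1 hMX hN1 hNX hR0 hl2'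
      (hl2 M hM1 α hα) (hl2 N hN1 β hβ) h'
  refine (abs_sum_sum_range_le hblock).trans ?_
  -- counting blocks, `log X'` versus `log x`
  have hD₁1 : 1 ≤ D / D₂ := by
    -- `2 ≤ 2^{K₁}`? not available for `K₁ = 0`; use the level directly: `D₂ ≤ D` as in Case A1
    have hD₂D : D₂ ≤ D := by
      calc D₂ ≤ x ^ (s - ε / 100 + 1 / 7) := rpow_scale_le hx105 hxX hX'x (by linarith) (by linarith)
        _ ≤ D := Real.rpow_le_rpow_of_exponent_le hx1 (by linarith)
    rwa [le_div_iff₀ hD₂0, one_mul]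
  have hD₁X : D / D₂ ≤ X' := hD₁le.trans (by
    calc X' ^ (4 / 7 - ε - (s - ε / 100)) ≤ X' ^ (1 : ℝ) :=
          Real.rpow_le_rpow_of_exponent_le hX'1.le (by linarith)
      _ = X' := Real.rpow_one X')
  have hD₂X : D₂ ≤ X' := by
    calc D₂ ≤ X' ^ (1 : ℝ) := Real.rpow_le_rpow_of_exponent_le hX'1.le (by linarith)
      _ = X' := Real.rpow_one X'
  have hK₁le : (K₁ : ℝ) ≤ 4 * Real.log X' := natCast_le_four_mul_log hK₁ hD₁1 hX'2 hD₁X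
  have hK₂le : (K₂ : ℝ) ≤ 4 * Real.log X' := natCast_le_four_mul_log hK₂' hD₂1 hX'2 hD₂X
  have hpow : Real.log X' ^ (2 * E' + 2) / Real.log X' ^ (A' / 2) ≤ (Real.log x ^ A₅)⁻¹ := by
    rw [← Real.rpow_natCast, ← Real.rpow_sub hLX0, ← Real.rpow_neg (by linarith)]
    have he : ((2 * E' + 2 : ℕ) : ℝ) - A' / 2 = -A₅ := by rw [hA']; push_cast; ring
    rw [he]
    exact Real.rpow_le_rpow_of_nonpos (by linarith) hLX (by linarith)
  calc (K₁ : ℝ) * K₂ * B ≤ (4 * Real.log X') * (4 * Real.log X') * B := by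
        have hK₂0 : (0 : ℝ) ≤ K₂ := Nat.cast_nonneg _
        exact mul_le_mul_of_nonneg_right (mul_le_mul hK₁le hK₂le hK₂0 (by positivity)) hB0
    _ = 32 * 2 ^ (2 * E') * Real.sqrt (max C₂ 0) * Cl * X' *
          (Real.log X' ^ (2 * E' + 2) / Real.log X' ^ (A' / 2)) := by
        rw [hB, mul_pow]; ring
    _ ≤ 32 * 2 ^ (2 * E') * Real.sqrt (max C₂ 0) * Cl * (2 ^ 15 * x) * (Real.log x ^ A₅)⁻¹ := by
        refine mul_le_mul (mul_le_mul_of_nonneg_left hX'x (by positivity)) hpow (by positivity)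
          (by positivity)
    _ = 32 * 2 ^ 15 * 2 ^ (2 * E') * Real.sqrt (max C₂ 0) * Cl * x / Real.log x ^ A₅ := by ring

/-! ### Case A2: the recombined small moduli, Theorem 0 (b) -/

/-- The large-`x` facts used by the remainder bound (one existential witness). [folklore] -/
theorem eventually_remainder (x₁ x₂ x₃ : ℝ) :
    ∃ x₀ : ℝ, ∀ x : ℝ, x₀ ≤ x → x₁ ≤ x ∧ x₂ ≤ x ∧ x₃ ≤ x ∧ Real.exp (Real.exp 1) ≤ x ∧ (2 : ℝ) ^ 20 ≤ x := by
  refine ⟨max x₁ (max x₂ (max x₃ (max (Real.exp (Real.exp 1)) (2 ^ 20)))), fun x hx => ⟨?_, ?_, ?_, ?_, ?_⟩⟩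
  · exact le_trans (le_max_left _ _) hx
  · exact le_trans ((le_max_left _ _).trans (le_max_right _ _)) hx
  · exact le_trans ((le_max_left _ _).trans ((le_max_right _ _).trans (le_max_right _ _))) hx
  · exact le_trans ((le_max_left _ _).trans ((le_max_right _ _).trans ((le_max_right _ _).trans
      (le_max_right _ _)))) hx
  · exact le_trans ((le_max_right _ _).trans ((le_max_right _ _).trans ((le_max_right _ _).trans
      (le_max_right _ _)))) hx

set_option maxHeartbeats 400000 in
/-- **Case A2 of §17, the small moduli kept for Theorem 0 (b)** (BFI (15.3), p. 244: "in the
opposite case the estimate (15.1) follows from the Bombieri mean-value theorem").  The moduli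
`d = qr` with `q ≤ Q₀`, `r ≤ R₀` and `Q₀ R₀ ≤ X'^{1/2−2ε}` are recombined:
`|∑_{q≤Q₀} ∑_{r≤R₀} λ₁(q)λ₂(r) 1_{(qr,a)=1} Δ_{α⋆β}(qr)| ≤ ∑_{d ≤ Q₀R₀, (d,a)=1} τ(d)|Δ(d)|
 ≤ (∑ τ² |Δ|)^{1/2} (∑ |Δ|)^{1/2}`, the first factor by the trivial bound from BFI Lemma 3
(`sum_tau_pow_abs_bilinDisc_le`, `X'` times a power of `log X'`), the second by
`Literature.NumberTheory.Sieve.BombieriFriedlanderIwaniecTheorem0b` (saving any power of `log X'`).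
For `x ≤ X' ≤ 2^{15} x`, `N = X'^s`, `1/5 ≤ s ≤ 2/7`, `|α|, |β| ≤ τ^{13}` on `m ∼ M`, `n ∼ N`,
`β` with (A₂) (exponent `2`, constants `Csw`), `|λᵢ| ≤ 1`: the result is `≤ C x (log x)^{−A₅}`
for `x ≥ x₀`. [cite: BombieriFriedlanderIwaniecActa1986, §15 (15.3) p. 244; §2 Theorem 0 (b) p. 211] -/
theorem remainder_bound (h0b : BombieriFriedlanderIwaniecTheorem0b) (hL3 : BombieriFriedlanderIwaniecLemma3)
    {a : ℤ} (ha : a ≠ 0) {ε : ℝ} (hε : 0 < ε) (hε' : ε ≤ 1 / 1000) {A₅ : ℝ} (hA₅ : 0 ≤ A₅)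
    (Csw : ℝ → ℝ) :
    ∃ C x₀ : ℝ, 0 ≤ C ∧ ∀ x : ℝ, x₀ ≤ x → ∀ (X' M N s : ℝ) (α β lam₁ lam₂ : ℕ → ℝ) (Q₀ R₀ : ℕ),
      (∀ n, |lam₁ n| ≤ 1) → (∀ n, |lam₂ n| ≤ 1) →
      x ≤ X' → X' ≤ 2 ^ 15 * x → M * N = X' → N = X' ^ s → 1 / 5 ≤ s → s ≤ 2 / 7 →
      ((Q₀ * R₀ : ℕ) : ℝ) ≤ X' ^ (1 / 2 - 2 * ε) →
      (∀ m, |α m| ≤ (σ 0 m : ℝ) ^ 13) → (∀ m, α m ≠ 0 → m ∈ dyadic M) →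
      (∀ n, |β n| ≤ (σ 0 n : ℝ) ^ 13) → (∀ n, β n ≠ 0 → n ∈ dyadic N) →
      SiegelWalfiszHyp N 2 Csw β →
      |∑ q ∈ Icc 1 Q₀, ∑ r ∈ Icc 1 R₀,
          lam₁ q * lam₂ r * (if IsCoprime ((q * r : ℕ) : ℤ) a then bilinDisc a M N α β (q * r) else 0)| ≤
        C * x / Real.log x ^ A₅ := by
  -- constants of the trivial `τ²`-weighted bound
  obtain ⟨Bt, Ct, xt, hBt, hCt, ht⟩ := sum_tau_pow_abs_bilinDisc_le hL3 ha 13 2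
  set r : ℕ := ⌈Bt⌉₊ with hr
  obtain ⟨Cm, hCm, hm⟩ := exists_sum_dyadic_sigma_zero_pow_le (13 + r)
  obtain ⟨Em, hEm⟩ : ∃ Em : ℕ, Em = 2 ^ (13 + r + 1) := ⟨_, rfl⟩
  rw [← hEm] at hm
  obtain ⟨Ca, hCa, hCa'⟩ := exists_sum_abs_le_of_abs_le_sigma_zero_pow 13
  obtain ⟨E14, hE14⟩ : ∃ E14 : ℕ, E14 = 2 ^ (13 + 1) := ⟨_, rfl⟩
  rw [← hE14] at hCa'
  obtain ⟨Cφ, hCφ, hφ⟩ := exists_sum_sigma_zero_pow_div_totient_le_real 2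
  obtain ⟨Cl, hCl, hl2⟩ := exists_l2Sq_le_of_abs_le_sigma_zero_pow 13
  obtain ⟨E', hE'⟩ : ∃ E' : ℕ, 2 ^ (2 * 13 + 1) = 2 * E' := ⟨2 ^ 26, by norm_num⟩
  rw [hE'] at hl2
  set cF : ℝ := Bt + Em + 16 + 2 * E14 with hcF
  have hcF0 : 0 ≤ cF := by rw [hcF]; positivity
  set CF : ℝ := Ct * Cm * 2 ^ Em + Cφ * Ca ^ 2 * 2 ^ (2 * E14) with hCF
  have hCF0 : 0 ≤ CF := by rw [hCF]; positivity
  -- Theorem 0 (b)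
  set A'' : ℝ := 2 * A₅ + cF + 2 * E' + 1 with hA''
  have hA''0 : 0 < A'' := by rw [hA'']; positivity
  obtain ⟨B₁, C₀, x₀b, hB₁, h0b'⟩ := h0b.sum_filter_coprime_le (ε := ε / 100) (by positivity) hA''0
    (B := 2) (by norm_num) Csw
  obtain ⟨xℓ, hxℓ⟩ := exists_level_le_thm0b B₁ hε
  obtain ⟨x₀, hx₀⟩ := eventually_remainder xt x₀b xℓ
  refine ⟨2 ^ 15 * Real.sqrt (CF * (max C₀ 0 * Cl * 2 ^ (2 * E'))), x₀, by positivity,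
    fun x hx X' M N s α β lam₁ lam₂ Q₀ R₀ hl1 hl2' hxX hX'x hMN hNs hs1 hs2 hQR hα hαs hβ hβs hsw => ?_⟩
  obtain ⟨hxt, hx₀b, hxℓ', hxe, hx20⟩ := hx₀ x hx
  have hee : (2 : ℝ) < Real.exp (Real.exp 1) := by
    have h1 : (1 : ℝ) < Real.exp 1 := by have := Real.exp_one_gt_d9; linarith
    have h2 : Real.exp 1 < Real.exp (Real.exp 1) := Real.exp_lt_exp.2 h1
    have := Real.exp_one_gt_d9; linarith
  have hx2 : (2 : ℝ) ≤ x := by linarith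
  have hx0 : 0 < x := by linarith
  have hX'2 : (2 : ℝ) ≤ X' := hx2.trans hxX
  have hX'0 : 0 < X' := by linarith
  have hX'1 : (1 : ℝ) < X' := by linarith
  have hLx : 1 ≤ Real.log x := by
    rw [Real.le_log_iff_exp_le hx0]
    refine le_trans ?_ hxe
    exact Real.exp_le_exp.2 (by have := Real.exp_one_gt_d9; linarith)
  have hLX : Real.log x ≤ Real.log X' := Real.log_le_log hx0 hxX
  have hLX1 : 1 ≤ Real.log X' := hLx.trans hLX
  have hLX0 : 0 < Real.log X' := by linarith
  have h2LX1 : 1 ≤ 2 * Real.log X' := by linarith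
  -- sizes
  have hN1 : 1 ≤ N := by rw [hNs]; exact Real.one_le_rpow hX'1.le (by linarith)
  have hNX : N ≤ X' := by
    rw [hNs]
    calc X' ^ s ≤ X' ^ (1 : ℝ) := Real.rpow_le_rpow_of_exponent_le hX'1.le (by linarith)
      _ = X' := Real.rpow_one X'
  have hN0 : 0 < N := by linarith
  have hM : M = X' ^ (1 - s) := by
    have h : M = X' / N := by field_simp; linarith
    rw [h, hNs, Real.rpow_sub hX'0, Real.rpow_one]
  have hM1 : 1 ≤ M := by rw [hM]; exact Real.one_le_rpow hX'1.le (by linarith)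
  have hMX : M ≤ X' := by
    rw [hM]
    calc X' ^ (1 - s) ≤ X' ^ (1 : ℝ) := Real.rpow_le_rpow_of_exponent_le hX'1.le (by linarith)
      _ = X' := Real.rpow_one X'
  have hM0 : 0 < M := by linarith
  have h4N : 4 * N ^ 2 ≤ X' := by
    have h1 : N ^ 2 ≤ X' ^ (9 / 10 : ℝ) := by
      rw [hNs, ← Real.rpow_natCast, ← Real.rpow_mul hX'0.le]
      exact Real.rpow_le_rpow_of_exponent_le hX'1.le (by push_cast; linarith)
    have h2 : (4 : ℝ) ≤ X' ^ (1 / 10 : ℝ) := by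
      have h3 : (2 : ℝ) ^ 20 ≤ X' := hx20.trans hxX
      have h4 : ((4 : ℝ)) ^ (10 : ℕ) ≤ (X' ^ (1 / 10 : ℝ)) ^ (10 : ℕ) := by
        rw [← Real.rpow_natCast (X' ^ (1 / 10 : ℝ)) 10, ← Real.rpow_mul hX'0.le]
        norm_num; linarith
      exact (pow_le_pow_iff_left₀ (by norm_num) (Real.rpow_nonneg hX'0.le _) (by norm_num)).1 h4
    calc 4 * N ^ 2 ≤ X' ^ (1 / 10 : ℝ) * X' ^ (9 / 10 : ℝ) :=
          mul_le_mul h2 h1 (sq_nonneg _) (Real.rpow_nonneg hX'0.le _)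
      _ = X' := by rw [← Real.rpow_add hX'0]; norm_num
  -- the level `Q₀ R₀ ≤ X'^{1/2} (log X')^{-B₁} ≤ X'`
  have hlev : ((Q₀ * R₀ : ℕ) : ℝ) ≤ X' ^ (1 / 2 : ℝ) / Real.log X' ^ B₁ := hQR.trans (hxℓ X' (hxℓ'.trans hxX))
  have hlevX : ((Q₀ * R₀ : ℕ) : ℝ) ≤ X' := by
    refine hQR.trans ?_
    calc X' ^ (1 / 2 - 2 * ε) ≤ X' ^ (1 : ℝ) := Real.rpow_le_rpow_of_exponent_le hX'1.le (by linarith)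
      _ = X' := Real.rpow_one X'
  -- scalar bounds: `∑ |β_n| τ(n)^{Bt}`, `‖α‖₁`, `‖β‖₁`, `∑ τ²/φ`, `√‖α‖²`, `√‖β‖²`
  have hlogT : ∀ {T : ℝ}, 1 ≤ T → T ≤ X' → Real.log (2 * T) ≤ 2 * Real.log X' := by
    intro T hT1 hTX
    have h1 : 2 * T ≤ X' ^ 2 := by nlinarith
    calc Real.log (2 * T) ≤ Real.log (X' ^ 2) := Real.log_le_log (by linarith) h1
      _ = 2 * Real.log X' := by rw [Real.log_pow]; norm_num
  have hβτ : ∑ n ∈ dyadic N, |β n| * (σ 0 n : ℝ) ^ Bt ≤ Cm * N * (2 * Real.log X') ^ Em := by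
    have h1 : ∑ n ∈ dyadic N, |β n| * (σ 0 n : ℝ) ^ Bt ≤ ∑ n ∈ dyadic N, (σ 0 n : ℝ) ^ (13 + r) := by
      refine Finset.sum_le_sum fun n hn => ?_
      have hn0 : n ≠ 0 := (pos_of_mem_dyadic hN0.le hn).ne'
      have hτ1 : (1 : ℝ) ≤ (σ 0 n : ℝ) := by exact_mod_cast one_le_sigma_zero hn0
      rw [pow_add]
      refine mul_le_mul (hβ n) ?_ (Real.rpow_nonneg (by positivity) _) (by positivity)
      rw [← Real.rpow_natCast]
      exact Real.rpow_le_rpow_of_exponent_le hτ1 (Nat.le_ceil Bt)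
    refine h1.trans ((hm N hN1).trans ?_)
    exact mul_le_mul_of_nonneg_left (pow_le_pow_left₀ (Real.log_nonneg (by linarith)) (hlogT hN1 hNX) Em)
      (by positivity)
  have hα1 : ∑ m ∈ dyadic M, |α m| ≤ Ca * M * (2 * Real.log X') ^ E14 :=
    (hCa' M hM1 α hα).trans (mul_le_mul_of_nonneg_left
      (pow_le_pow_left₀ (Real.log_nonneg (by linarith)) (hlogT hM1 hMX) E14) (by positivity))
  have hβ1 : ∑ n ∈ dyadic N, |β n| ≤ Ca * N * (2 * Real.log X') ^ E14 :=
    (hCa' N hN1 β hβ).trans (mul_le_mul_of_nonneg_left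
      (pow_le_pow_left₀ (Real.log_nonneg (by linarith)) (hlogT hN1 hNX) E14) (by positivity))
  have hΦ : ∑ d ∈ Icc 1 (Q₀ * R₀), (σ 0 d : ℝ) ^ 2 / (Nat.totient d : ℝ) ≤ Cφ * Real.log X' ^ 16 := by
    have h := hφ X' hX'2
    norm_num at h
    exact le_trans (Finset.sum_le_sum_of_subset_of_nonneg (Finset.Icc_subset_Icc le_rfl (Nat.le_floor hlevX))
      fun _ _ _ => by positivity) h
  have hsα : Real.sqrt (l2Sq M α) ≤ Real.sqrt Cl * Real.sqrt M * (2 * Real.log X') ^ E' :=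
    sqrt_l2Sq_le hM1 hMX hX'2 hCl (hl2 M hM1 α hα)
  have hsβ : Real.sqrt (l2Sq N β) ≤ Real.sqrt Cl * Real.sqrt N * (2 * Real.log X') ^ E' :=
    sqrt_l2Sq_le hN1 hNX hX'2 hCl (hl2 N hN1 β hβ)
  -- `F₁ ≤ CF X' (log X')^{cF}`
  have hmono : ∀ {u : ℝ} {n : ℕ}, 0 ≤ u → u + n ≤ cF →
      Real.log X' ^ u * (2 * Real.log X') ^ n ≤ 2 ^ n * Real.log X' ^ cF := by
    intro u n hu hun
    rw [mul_pow, mul_left_comm]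
    refine mul_le_mul_of_nonneg_left ?_ (by positivity)
    rw [← Real.rpow_natCast, ← Real.rpow_add hLX0]
    exact Real.rpow_le_rpow_of_exponent_le hLX1 hun
  have hF1' : Ct * M * Real.log X' ^ Bt * (∑ n ∈ dyadic N, |β n| * (σ 0 n : ℝ) ^ Bt) +
      (∑ d ∈ Icc 1 (Q₀ * R₀), (σ 0 d : ℝ) ^ 2 / (Nat.totient d : ℝ)) * (∑ m ∈ dyadic M, |α m|) *
        (∑ n ∈ dyadic N, |β n|) ≤ CF * X' * Real.log X' ^ cF := by
    have i1 : Ct * M * Real.log X' ^ Bt * (∑ n ∈ dyadic N, |β n| * (σ 0 n : ℝ) ^ Bt) ≤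
        Ct * Cm * 2 ^ Em * X' * Real.log X' ^ cF := by
      have j1 := mul_le_mul_of_nonneg_left hβτ
        (show 0 ≤ Ct * M * Real.log X' ^ Bt from mul_nonneg (mul_nonneg hCt hM0.le) (Real.rpow_nonneg hLX0.le _))
      have j2 : Ct * M * Real.log X' ^ Bt * (Cm * N * (2 * Real.log X') ^ Em) =
          Ct * Cm * (M * N) * (Real.log X' ^ Bt * (2 * Real.log X') ^ Em) := by ring
      have j3 := hmono hBt (show Bt + (Em : ℕ) ≤ cF by
        rw [hcF]; linarith [show (0:ℝ) ≤ E14 from Nat.cast_nonneg _])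
      have j4 := mul_le_mul_of_nonneg_left j3
        (show 0 ≤ Ct * Cm * (M * N) from mul_nonneg (mul_nonneg hCt hCm.le) (mul_nonneg hM0.le hN0.le))
      rw [hMN] at j2 j4
      calc _ ≤ _ := j1
        _ = _ := j2
        _ ≤ _ := j4
        _ = Ct * Cm * 2 ^ Em * X' * Real.log X' ^ cF := by ring
    have i2 : (∑ d ∈ Icc 1 (Q₀ * R₀), (σ 0 d : ℝ) ^ 2 / (Nat.totient d : ℝ)) * (∑ m ∈ dyadic M, |α m|) *
        (∑ n ∈ dyadic N, |β n|) ≤ Cφ * Ca ^ 2 * 2 ^ (2 * E14) * X' * Real.log X' ^ cF := by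
      have j0 : 0 ≤ Cφ * Real.log X' ^ 16 := by positivity
      have j1 : (∑ d ∈ Icc 1 (Q₀ * R₀), (σ 0 d : ℝ) ^ 2 / (Nat.totient d : ℝ)) * (∑ m ∈ dyadic M, |α m|) ≤
          (Cφ * Real.log X' ^ 16) * (Ca * M * (2 * Real.log X') ^ E14) :=
        mul_le_mul hΦ hα1 (Finset.sum_nonneg fun _ _ => abs_nonneg _) j0
      have j2 := mul_le_mul j1 hβ1 (Finset.sum_nonneg fun _ _ => abs_nonneg _)
        (mul_nonneg j0 (by positivity))
      have j3 : (Cφ * Real.log X' ^ 16) * (Ca * M * (2 * Real.log X') ^ E14) * (Ca * N * (2 * Real.log X') ^ E14) =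
          Cφ * Ca ^ 2 * (M * N) * (Real.log X' ^ ((16 : ℕ) : ℝ) * (2 * Real.log X') ^ (2 * E14)) := by
        rw [Real.rpow_natCast]; ring
      have j5 := hmono (show (0:ℝ) ≤ ((16 : ℕ) : ℝ) by positivity)
        (show (((16 : ℕ) : ℝ)) + ((2 * E14 : ℕ) : ℝ) ≤ cF by rw [hcF]; push_cast; linarith [show (0:ℝ) ≤ Em from Nat.cast_nonneg _])
      have j6 := mul_le_mul_of_nonneg_left j5
        (show 0 ≤ Cφ * Ca ^ 2 * (M * N) from mul_nonneg (by positivity) (mul_nonneg hM0.le hN0.le))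
      rw [hMN] at j3 j6
      calc _ ≤ _ := j2
        _ = _ := j3
        _ ≤ _ := j6
        _ = Cφ * Ca ^ 2 * 2 ^ (2 * E14) * X' * Real.log X' ^ cF := by ring
    calc _ ≤ Ct * Cm * 2 ^ Em * X' * Real.log X' ^ cF + Cφ * Ca ^ 2 * 2 ^ (2 * E14) * X' * Real.log X' ^ cF :=
          add_le_add i1 i2
      _ = CF * X' * Real.log X' ^ cF := by rw [hCF]; ring
  -- `F₂ ≤ C₀⁺ Cl 2^{2E'} X' (log X')^{2E' - A''}`
  have hNrange : X' ^ (ε / 100) ≤ N ∧ N ≤ X' ^ (1 - ε / 100) := by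
    rw [hNs]
    exact ⟨Real.rpow_le_rpow_of_exponent_le hX'1.le (by linarith),
      Real.rpow_le_rpow_of_exponent_le hX'1.le (by linarith)⟩
  have hF2 : ∑ q ∈ (Icc 1 ⌊((Q₀ * R₀ : ℕ) : ℝ)⌋₊).filter (fun q : ℕ => IsCoprime (q : ℤ) a),
      |bilinDisc a M N α β q| ≤ max C₀ 0 * Cl * 2 ^ (2 * E') * X' * Real.log X' ^ (2 * E') / Real.log X' ^ A'' := by
    have h := h0b' X' (hx₀b.trans hxX) M N hMN hNrange.1 hNrange.2 β hsw α _ hlev a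
    refine h.trans ?_
    have hden : 0 < Real.log X' ^ A'' := Real.rpow_pos_of_pos hLX0 _
    exact div_le_div_of_nonneg_right (thm0b_bound_algebra hCl hM0.le hX'0.le hMN hLX0.le
      (Real.sqrt_nonneg _) (Real.sqrt_nonneg _) hsα hsβ) hden.le
  have hL : Real.log X' ^ (-A₅ - 1 / 2) ≤ (Real.log x ^ A₅)⁻¹ := by
    rw [← Real.rpow_neg (zero_le_one.trans hLx)]
    calc Real.log X' ^ (-A₅ - 1 / 2) ≤ Real.log X' ^ (-A₅) :=
          Real.rpow_le_rpow_of_exponent_le hLX1 (by linarith only [hA₅])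
      _ ≤ Real.log x ^ (-A₅) :=
          Real.rpow_le_rpow_of_nonpos (zero_lt_one.trans_le hLx) hLX (by linarith only [hA₅])
  -- combine
  have hmain := ht X' M N (hxt.trans hxX) hN1 h4N hMN α β hα hαs hβs (Q₀ * R₀)
  have hF1 : ∑ d ∈ (Icc 1 (Q₀ * R₀)).filter (fun d : ℕ => IsCoprime (d : ℤ) a),
      (σ 0 d : ℝ) ^ 2 * |bilinDisc a M N α β d| ≤ CF * X' * Real.log X' ^ cF :=
    (Finset.sum_le_sum_of_subset_of_nonneg (Finset.filter_subset _ _)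
      fun _ _ _ => mul_nonneg (sq_nonneg _) (abs_nonneg _)).trans (hmain.trans hF1')
  rw [Nat.floor_natCast] at hF2
  refine (abs_sum_sum_mul_ite_le hl1 hl2' Q₀ R₀ a (bilinDisc a M N α β)).trans ?_
  refine (sum_tau_mul_abs_le_sqrt _ _).trans ?_
  have hS0 : 0 ≤ ∑ d ∈ (Icc 1 (Q₀ * R₀)).filter (fun d : ℕ => IsCoprime (d : ℤ) a),
      (σ 0 d : ℝ) ^ 2 * |bilinDisc a M N α β d| :=
    Finset.sum_nonneg fun _ _ => mul_nonneg (sq_nonneg _) (abs_nonneg _)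
  rw [← Real.sqrt_mul hS0]
  have hprod : (∑ d ∈ (Icc 1 (Q₀ * R₀)).filter (fun d : ℕ => IsCoprime (d : ℤ) a),
      (σ 0 d : ℝ) ^ 2 * |bilinDisc a M N α β d|) *
      (∑ d ∈ (Icc 1 (Q₀ * R₀)).filter (fun d : ℕ => IsCoprime (d : ℤ) a), |bilinDisc a M N α β d|) ≤
      (CF * X' * Real.log X' ^ cF) *
        (max C₀ 0 * Cl * 2 ^ (2 * E') * X' * Real.log X' ^ (2 * E') / Real.log X' ^ A'') :=
    mul_le_mul hF1 hF2 (Finset.sum_nonneg fun _ _ => abs_nonneg _)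
      (mul_nonneg (mul_nonneg hCF0 hX'0.le) (Real.rpow_nonneg hLX0.le _))
  refine (Real.sqrt_le_sqrt hprod).trans ?_
  -- `√(CF X' L^{cF} · C₀⁺ Cl 2^{2E'} X' L^{2E'} / L^{A''}) = √(CF C₀⁺ Cl 2^{2E'}) X' L^{-A₅ - 1/2} ≤ …`
  have hexp : Real.log X' ^ cF * (Real.log X' ^ (2 * E') / Real.log X' ^ A'') = (Real.log X' ^ (-A₅ - 1 / 2)) ^ 2 := by
    rw [← Real.rpow_natCast _ (2 * E'), ← Real.rpow_sub hLX0, ← Real.rpow_add hLX0, ← Real.rpow_natCast,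
      ← Real.rpow_mul hLX0.le]
    congr 1; rw [hA'']; push_cast; ring
  have hrew : (CF * X' * Real.log X' ^ cF) *
      (max C₀ 0 * Cl * 2 ^ (2 * E') * X' * Real.log X' ^ (2 * E') / Real.log X' ^ A'') =
      (Real.sqrt (CF * (max C₀ 0 * Cl * 2 ^ (2 * E'))) * X' * Real.log X' ^ (-A₅ - 1 / 2)) ^ 2 := by
    have hK0 : 0 ≤ CF * (max C₀ 0 * Cl * 2 ^ (2 * E')) :=
      mul_nonneg hCF0 (mul_nonneg (mul_nonneg (le_max_right _ _) hCl.le) (pow_nonneg zero_le_two _))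
    rw [mul_pow, mul_pow, Real.sq_sqrt hK0, ← hexp]; ring
  have hfin0 : 0 ≤ Real.sqrt (CF * (max C₀ 0 * Cl * 2 ^ (2 * E'))) * X' * Real.log X' ^ (-A₅ - 1 / 2) :=
    mul_nonneg (mul_nonneg (Real.sqrt_nonneg _) hX'0.le) (Real.rpow_nonneg hLX0.le _)
  rw [hrew, Real.sqrt_sq hfin0]
  calc Real.sqrt (CF * (max C₀ 0 * Cl * 2 ^ (2 * E'))) * X' * Real.log X' ^ (-A₅ - 1 / 2)
      ≤ Real.sqrt (CF * (max C₀ 0 * Cl * 2 ^ (2 * E'))) * (2 ^ 15 * x) * (Real.log x ^ A₅)⁻¹ :=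
        mul_le_mul (mul_le_mul_of_nonneg_left hX'x (Real.sqrt_nonneg _)) hL (Real.rpow_nonneg hLX0.le _)
          (mul_nonneg (Real.sqrt_nonneg _) (mul_nonneg (pow_nonneg zero_le_two _) hx0.le))
    _ = 2 ^ 15 * Real.sqrt (CF * (max C₀ 0 * Cl * 2 ^ (2 * E'))) * x / Real.log x ^ A₅ := by ring

/-! ### Case A2 assembled -/

/-- **Case A2 of §17: a partial product in the range of Theorem 2** (with the small factors `r` of
the moduli recombined for Theorem 0 (b)).  Let `λ` be well factorable of level `D = x^{4/7−ε}`
(`0 < ε ≤ 1/1000`), `x ≤ X' ≤ 2^{15} x`, `MN = X'`, `N = X'^s` with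
`3/14 − ε/2 + ε/200 ≤ s ≤ 2/7 − 3ε/2`, `|α|, |β| ≤ τ^{13}` on `m ∼ M`, `n ∼ N`, `β` supported on
`z`-rough integers (`z ≥ exp(√log x)`), satisfying (A₂) (exponent `2`, constants `Csw`) and DENSE
(`N ≤ (log 2N)^{c_D} ‖β‖²`).  Then
`|∑_{d ≤ D, (d,a)=1} λ(d) Δ_{α⋆β}(d)| ≤ C x (log x)^{−A₅}` for `x ≥ x₀`
(`thm2_blocks_bound` for the blocks `R ≥ X'^{ρ_c}/2`, `remainder_bound` for `r ≤ X'^{ρ_c}`,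
`D₂ = X'^{s−ε/100}`).  (BFI §17 (17.2) p. 249 with (15.3) p. 244.)
[cite: BombieriFriedlanderIwaniecActa1986, §17 (17.2) p. 249] -/
theorem caseA2_bound (h2 : BombieriFriedlanderIwaniecTheorem2) (h0b : BombieriFriedlanderIwaniecTheorem0b)
    (hL3 : BombieriFriedlanderIwaniecLemma3) {a : ℤ} (ha : a ≠ 0)
    {ε : ℝ} (hε : 0 < ε) (hε' : ε ≤ 1 / 1000) {A₅ : ℝ} (hA₅ : 0 ≤ A₅) (Csw : ℝ → ℝ)
    {cD : ℝ} (hcD : 0 ≤ cD) :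
    ∃ C x₀ : ℝ, 0 ≤ C ∧ ∀ x : ℝ, x₀ ≤ x → ∀ (X' M N s z : ℝ) (α β : ArithmeticFunction ℝ) (lam : ℕ → ℝ),
      IsWellFactorable (x ^ (4 / 7 - ε)) lam →
      x ≤ X' → X' ≤ 2 ^ 15 * x → M * N = X' → N = X' ^ s →
      3 / 14 - ε / 2 + ε / 200 ≤ s → s ≤ 2 / 7 - 3 / 2 * ε →
      Real.exp (Real.sqrt (Real.log x)) ≤ z →
      (∀ m, |α m| ≤ (σ 0 m : ℝ) ^ 13) → (∀ m, α m ≠ 0 → m ∈ dyadic M) →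
      (∀ n, |β n| ≤ (σ 0 n : ℝ) ^ 13) → (∀ n, β n ≠ 0 → n ∈ dyadic N) →
      (∀ n, β n ≠ 0 → IsRough z n) →
      SiegelWalfiszHyp N 2 Csw β →
      N ≤ Real.log (2 * N) ^ cD * l2Sq N β →
      |∑ d ∈ (Icc 1 ⌊x ^ (4 / 7 - ε)⌋₊).filter (fun d : ℕ => IsCoprime (d : ℤ) a),
          lam d * bilinDisc a M N α β d| ≤ C * x / Real.log x ^ A₅ := by
  obtain ⟨C₁, x₁, hC₁, hblk⟩ := thm2_blocks_bound h2 ha hε hε' hA₅ Csw hcD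
  obtain ⟨C₂, x₂, hC₂, hrem⟩ := remainder_bound h0b hL3 ha hε hε' hA₅ Csw
  obtain ⟨x₀, hx₀⟩ := eventually_caseA1 x₁ x₂
  refine ⟨C₁ + C₂, x₀, by positivity,
    fun x hx X' M N s z α β lam hlam hxX hX'x hMN hNs hs1 hs2 hz hα hαs hβ hβs hβr hsw hdense => ?_⟩
  obtain ⟨hx₁, hx₂, hxe, hx105⟩ := hx₀ x hx
  have hee : (2 : ℝ) < Real.exp (Real.exp 1) := by
    have h1 : (1 : ℝ) < Real.exp 1 := by have := Real.exp_one_gt_d9; linarith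
    have h2 : Real.exp 1 < Real.exp (Real.exp 1) := Real.exp_lt_exp.2 h1
    have := Real.exp_one_gt_d9; linarith
  have hx2 : (2 : ℝ) ≤ x := by linarith
  have hx0 : 0 < x := by linarith
  have hx1 : (1 : ℝ) ≤ x := by linarith
  have hX'2 : (2 : ℝ) ≤ X' := hx2.trans hxX
  have hX'0 : 0 < X' := by linarith
  have hX'1 : (1 : ℝ) < X' := by linarith
  have hLx : 1 ≤ Real.log x := by
    rw [Real.le_log_iff_exp_le hx0]
    refine le_trans ?_ hxe
    exact Real.exp_le_exp.2 (by have := Real.exp_one_gt_d9; linarith)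
  -- the levels
  set D : ℝ := x ^ (4 / 7 - ε) with hD
  set D₂ : ℝ := X' ^ (s - ε / 100) with hD₂
  set ρ : ℝ := 1 / 7 - 2 * ε + 5 * (ε / 100) with hρ
  have hD₂1 : 1 ≤ D₂ := Real.one_le_rpow hX'1.le (by linarith)
  have hD₂0 : 0 < D₂ := by linarith
  have hD₂D : D₂ ≤ D := by
    calc D₂ ≤ x ^ (s - ε / 100 + 1 / 7) := rpow_scale_le hx105 hxX hX'x (by linarith) (by linarith)
      _ ≤ D := Real.rpow_le_rpow_of_exponent_le hx1 (by linarith)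
  have hD₁le : D / D₂ ≤ X' ^ (4 / 7 - ε - (s - ε / 100)) := by
    have h1 : D ≤ X' ^ (4 / 7 - ε) := Real.rpow_le_rpow hx0.le hxX (by linarith)
    rw [div_le_iff₀ hD₂0]
    have h2' : X' ^ (4 / 7 - ε - (s - ε / 100)) * D₂ = X' ^ (4 / 7 - ε) := by
      rw [hD₂, ← Real.rpow_add hX'0]; congr 1; ring
    rw [h2']; exact h1
  have hXρ1 : 1 ≤ X' ^ ρ := Real.one_le_rpow hX'1.le (by rw [hρ]; linarith)
  have hXρ0 : 0 < X' ^ ρ := by linarith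
  have hρD₂ : X' ^ ρ ≤ D₂ := Real.rpow_le_rpow_of_exponent_le hX'1.le (by rw [hρ]; linarith)
  obtain ⟨lam₁, lam₂, K₁, hl1, hl2, hs1', hs2', hK₁, hblocks, hdec⟩ := wellFactorable_blocks hlam hD₂1 hD₂D
  -- the depth `K₂`: `D₂/2^{K₂} ∈ [X'^ρ/2, X'^ρ)`
  have hT : 1 ≤ D₂ / X' ^ ρ := by rwa [le_div_iff₀ hXρ0, one_mul]
  obtain ⟨K₂, hK₂a, hK₂b⟩ := exists_pow_two_near hT
  have hK₂' : (2 : ℝ) ^ K₂ ≤ 2 * D₂ := by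
    refine hK₂b.trans ?_
    rw [mul_div_assoc']
    exact (div_le_self (by positivity) hXρ1)
  have hK₂lo : X' ^ ρ / 2 ≤ D₂ / 2 ^ K₂ := by
    rw [div_le_div_iff₀ (by norm_num) (by positivity)]
    have : (2 : ℝ) ^ K₂ * X' ^ ρ ≤ 2 * D₂ := by
      have h := mul_le_mul_of_nonneg_right hK₂b hXρ0.le
      rwa [mul_assoc, div_mul_cancel₀ _ hXρ0.ne'] at h
    linarith
  have hK₂hi : D₂ / 2 ^ K₂ < X' ^ ρ := by
    rw [div_lt_iff₀ (by positivity)]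
    have h := mul_lt_mul_of_pos_right hK₂a hXρ0
    rw [div_mul_cancel₀ _ hXρ0.ne'] at h
    linarith
  -- decomposition
  rw [hdec a M N α β K₂]
  refine (abs_add_le _ _).trans ?_
  rw [show (C₁ + C₂) * x / Real.log x ^ A₅ = C₂ * x / Real.log x ^ A₅ + C₁ * x / Real.log x ^ A₅ by ring]
  refine add_le_add ?_ ?_
  · -- the remainder, level `⌊D/D₂⌋ ⌊D₂/2^{K₂}⌋ ≤ X'^{1/2 - 2ε}`
    have hlev : (((⌊D / D₂⌋₊ * ⌊D₂ / 2 ^ K₂⌋₊ : ℕ)) : ℝ) ≤ X' ^ (1 / 2 - 2 * ε) := by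
      push_cast
      calc (⌊D / D₂⌋₊ : ℝ) * (⌊D₂ / 2 ^ K₂⌋₊ : ℝ) ≤ (D / D₂) * (D₂ / 2 ^ K₂) :=
            mul_le_mul (Nat.floor_le (by positivity)) (Nat.floor_le (by positivity)) (Nat.cast_nonneg _)
              (by positivity)
        _ ≤ X' ^ (4 / 7 - ε - (s - ε / 100)) * X' ^ ρ :=
            mul_le_mul hD₁le hK₂hi.le (by positivity) (Real.rpow_nonneg hX'0.le _)
        _ ≤ X' ^ (1 / 2 - 2 * ε) := by rw [hρ]; exact thm0b_level hε hs1 hX'1.le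
    exact hrem x hx₂ X' M N s α β lam₁ lam₂ ⌊D / D₂⌋₊ ⌊D₂ / 2 ^ K₂⌋₊ hl1 hl2 hxX hX'x hMN hNs
      (by linarith) (by linarith) hlev hα hαs hβ hβs hsw
  · exact hblk x hx₁ X' M N s z α β lam₁ lam₂ K₁ K₂ hl1 hl2 hxX hX'x hMN hNs hs1 hs2 hz hK₁ hK₂'
      hK₂lo hα hβ hβr hsw hdense

end BFI

end Literature.NumberTheory.Sieve
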